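import Literature.Analysis.FunctionSpaces.TimeMollification
import HarnessLib

/-!
# Space–time `L²` convergence: almost every slice converges along a subsequence

Analysis/FluidPDE support file (all results proved, no definitions, no named facts) for the
discharge of `Literature.Analysis.FluidPDE.bradshawTsai2019_limitDatum`
(`ForwardDSSCylinderLimitParts.lean`; Bradshaw–Tsai, Analysis & PDE 12 (2019) =
arXiv:1801.08060, §4.3, p. 12), where a space–time limit `v_k → u` in `L²((0,T) × B₁)` has to be
evaluated at (almost every) fixed time. The folklore facts (Brezis, *Functional Analysis*,
Thm. 4.9: an `L^p`-convergent sequence has an a.e. convergent subsequence, applied to the slice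
norms through Tonelli) proved here:

* `exists_subseq_ae_tendsto_lintegral_slice` — if `∫∫_{I × B} ‖f_j − g‖² → 0` then along a
  subsequence `τ`, for a.e. `t ∈ I`, `∫_B ‖f_{τ j}(t) − g(t)‖² → 0` (choose `τ` with
  `∫∫ ‖f_{τ j} − g‖² ≤ 2^{-j}`; the sum over `j` of the slice errors is integrable in `t`);
* `enorm_sq_le_peterPaul`, `lintegral_sq_mul_le_peterPaul` —
  `‖a‖² ≤ (1 + 1/λ)‖a − b‖² + (‖b‖² + λ‖b‖²)` and its weighted integral;
* `lintegral_sq_mul_le_of_tendsto`, `eventually_lintegral_sq_mul_le_add` — one-sided passage to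
  the limit in weighted squares `∫ ‖·‖² ψ` (`0 ≤ ψ ≤ Ψ`, `ψ = 0` off `B`) under
  `∫_B ‖f_j − g‖² → 0`, in `ℝ≥0∞` and without extracting further subsequences;
* `tendsto_integral_inner_of_tendsto_lintegral` — pairings `∫ ⟪f_j, η⟫ → ∫ ⟪g, η⟫` against bounded
  fields `η` vanishing off a set `B` of finite measure (Cauchy–Schwarz).

## Mathlib / tree search

Mathlib: `Filter.extraction_forall_of_eventually`, `lintegral_tsum`,
`ENNReal.tendsto_atTop_zero_of_tsum_ne_top`, `ae_lt_top'`, `lintegral_prod`,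
`ENNReal.lintegral_mul_le_Lp_mul_Lq`; tree: `FunctionSpaces.enorm_integral_inner_le_eLpNorm_mul`,
`FunctionSpaces.integrable_inner_of_eLpNorm_two_lt_top` (`TimeMollification.lean`). No
slice-extraction lemma found (`lean search 'slice.*subseq|subseq.*slice|ae_tendsto.*lintegral'`).

## References

* H. Brezis, *Functional Analysis, Sobolev Spaces and Partial Differential Equations* (2011),
  Thm. 4.9. [Brezis2011]
* Z. Bradshaw, T.-P. Tsai, Analysis & PDE 12 (2019) = arXiv:1801.08060, §4.3. [BradshawTsai2019]
-/

noncomputable section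

open MeasureTheory Set Function Filter Topology
open scoped NNReal ENNReal InnerProductSpace RealInnerProductSpace

namespace Literature.Analysis.FluidPDE

/-! ### Extraction of a subsequence converging on almost every slice -/

section Extraction

variable {E : Type*} [MeasureSpace E]
variable {X : Type*} [NormedAddCommGroup X]

/-- Tonelli for the squared slice errors on `I × B`. [folklore] -/
theorem lintegral_slice_sq_eq [SFinite (volume : Measure E)] {I : Set ℝ} {B : Set E} {h : ℝ → E → X}
    (hh : AEStronglyMeasurable (uncurry h) (volume.restrict (I ×ˢ B))) :
    ∫⁻ t in I, ∫⁻ x in B, ‖h t x‖ₑ ^ 2 = ∫⁻ z in I ×ˢ B, ‖h z.1 z.2‖ₑ ^ 2 := by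
  have hprod : (volume.restrict (I ×ˢ B) : Measure (ℝ × E)) =
      (volume.restrict I).prod (volume.restrict B) := by
    rw [Measure.volume_eq_prod, Measure.prod_restrict]
  have hm : AEMeasurable (fun z : ℝ × E => ‖h z.1 z.2‖ₑ ^ 2)
      ((volume.restrict I).prod (volume.restrict B)) := by
    rw [← hprod]; exact hh.enorm.pow_const 2
  rw [hprod, lintegral_prod _ hm]

/-- The slice error `t ↦ ∫_B ‖h(t)‖²` is a.e.-measurable on `I`. [folklore] -/
theorem aemeasurable_lintegral_slice_sq [SFinite (volume : Measure E)] {I : Set ℝ} {B : Set E}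
    {h : ℝ → E → X}
    (hh : AEStronglyMeasurable (uncurry h) (volume.restrict (I ×ˢ B))) :
    AEMeasurable (fun t => ∫⁻ x in B, ‖h t x‖ₑ ^ 2) (volume.restrict I) := by
  have hprod : (volume.restrict (I ×ˢ B) : Measure (ℝ × E)) =
      (volume.restrict I).prod (volume.restrict B) := by
    rw [Measure.volume_eq_prod, Measure.prod_restrict]
  have hm : AEMeasurable (fun z : ℝ × E => ‖h z.1 z.2‖ₑ ^ 2)
      ((volume.restrict I).prod (volume.restrict B)) := by
    rw [← hprod]; exact hh.enorm.pow_const 2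
  exact hm.lintegral_prod_right'

/-- **An `L²(I × B)`-convergent sequence converges in `L²(B)` on almost every slice, along a
subsequence** (Brezis 2011, Thm. 4.9, through Tonelli): if `∫∫_{I×B} ‖f_j − g‖² → 0` then there
is a strictly increasing `τ` with `∫_B ‖f_{τ j}(t) − g(t)‖² → 0` for a.e. `t ∈ I`. [cite: Brezis2011, Thm. 4.9] -/
theorem exists_subseq_ae_tendsto_lintegral_slice [SFinite (volume : Measure E)] {I : Set ℝ} {B : Set E}
    {f : ℕ → ℝ → E → X}
    {g : ℝ → E → X} (hf : ∀ j, AEStronglyMeasurable (uncurry (f j)) (volume.restrict (I ×ˢ B)))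
    (hg : AEStronglyMeasurable (uncurry g) (volume.restrict (I ×ˢ B)))
    (h : Tendsto (fun j => ∫⁻ z in I ×ˢ B, ‖f j z.1 z.2 - g z.1 z.2‖ₑ ^ 2) atTop (𝓝 0)) :
    ∃ τ : ℕ → ℕ, StrictMono τ ∧ ∀ᵐ t ∂(volume.restrict I),
      Tendsto (fun j => ∫⁻ x in B, ‖f (τ j) t x - g t x‖ₑ ^ 2) atTop (𝓝 0) := by
  set a : ℕ → ℝ≥0∞ := fun j => ∫⁻ z in I ×ˢ B, ‖f j z.1 z.2 - g z.1 z.2‖ₑ ^ 2 with ha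
  -- a fast subsequence
  have hev : ∀ n : ℕ, ∀ᶠ k in atTop, a k < (2⁻¹ : ℝ≥0∞) ^ n := fun n =>
    h.eventually (gt_mem_nhds (ENNReal.pow_pos (by norm_num) n))
  obtain ⟨τ, hτ, hτa⟩ := extraction_forall_of_eventually hev
  refine ⟨τ, hτ, ?_⟩
  -- the slice errors and their sum
  have hdiff : ∀ j, AEStronglyMeasurable (uncurry fun t x => f (τ j) t x - g t x)
      (volume.restrict (I ×ˢ B)) := fun j => (hf (τ j)).sub hg
  set d : ℕ → ℝ → ℝ≥0∞ := fun j t => ∫⁻ x in B, ‖f (τ j) t x - g t x‖ₑ ^ 2 with hd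
  have hdm : ∀ j, AEMeasurable (d j) (volume.restrict I) := fun j =>
    aemeasurable_lintegral_slice_sq (hdiff j)
  have hdint : ∀ j, ∫⁻ t in I, d j t = a (τ j) := fun j => lintegral_slice_sq_eq (hdiff j)
  have hsum : ∫⁻ t in I, ∑' j, d j t ≤ 2 := by
    rw [lintegral_tsum hdm]
    calc ∑' j, ∫⁻ t in I, d j t = ∑' j, a (τ j) := by simp_rw [hdint]
      _ ≤ ∑' j : ℕ, (2⁻¹ : ℝ≥0∞) ^ j := ENNReal.tsum_le_tsum fun j => (hτa j).le
      _ = 2 := by rw [ENNReal.tsum_geometric, ENNReal.one_sub_inv_two, inv_inv]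
  have hfin : ∀ᵐ t ∂(volume.restrict I), ∑' j, d j t < ∞ :=
    ae_lt_top' (AEMeasurable.tsum hdm) (ne_top_of_le_ne_top ENNReal.ofNat_ne_top hsum)
  filter_upwards [hfin] with t ht
  exact ENNReal.tendsto_atTop_zero_of_tsum_ne_top ht.ne

end Extraction

/-! ### One-sided limits of weighted squares -/

section Weighted

variable {X : Type*} [NormedAddCommGroup X]

/-- Peter–Paul in `ℝ≥0∞`: `‖a‖² ≤ (1 + 1/λ) ‖a − b‖² + (‖b‖² + λ ‖b‖²)` for `λ > 0`. [folklore] -/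
theorem enorm_sq_le_peterPaul (a b : X) {l : ℝ} (hl : 0 < l) :
    ‖a‖ₑ ^ 2 ≤ ENNReal.ofReal (1 + 1 / l) * ‖a - b‖ₑ ^ 2 + (‖b‖ₑ ^ 2 + ENNReal.ofReal l * ‖b‖ₑ ^ 2) := by
  have key : ‖a‖ ^ 2 ≤ (1 + 1 / l) * ‖a - b‖ ^ 2 + (‖b‖ ^ 2 + l * ‖b‖ ^ 2) := by
    have h1 : ‖a‖ ≤ ‖a - b‖ + ‖b‖ := norm_le_norm_sub_add a b
    have h2 : ‖a‖ ^ 2 ≤ (‖a - b‖ + ‖b‖) ^ 2 := pow_le_pow_left₀ (norm_nonneg _) h1 2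
    have h3 : 2 * (‖a - b‖ * ‖b‖) ≤ (1 / l) * ‖a - b‖ ^ 2 + l * ‖b‖ ^ 2 := by
      have h4 : 0 ≤ (‖a - b‖ / l - ‖b‖) ^ 2 * l := by positivity
      have h5 : (‖a - b‖ / l - ‖b‖) ^ 2 * l =
          (1 / l) * ‖a - b‖ ^ 2 + l * ‖b‖ ^ 2 - 2 * (‖a - b‖ * ‖b‖) := by
        field_simp
        ring
      linarith
    nlinarith
  have e1 : ∀ c : X, ‖c‖ₑ ^ 2 = ENNReal.ofReal (‖c‖ ^ 2) := fun c => by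
    rw [← ofReal_norm, ENNReal.ofReal_pow (norm_nonneg _)]
  rw [e1, e1, e1]
  calc ENNReal.ofReal (‖a‖ ^ 2)
      ≤ ENNReal.ofReal ((1 + 1 / l) * ‖a - b‖ ^ 2 + (‖b‖ ^ 2 + l * ‖b‖ ^ 2)) :=
        ENNReal.ofReal_le_ofReal key
    _ = ENNReal.ofReal (1 + 1 / l) * ENNReal.ofReal (‖a - b‖ ^ 2) +
          (ENNReal.ofReal (‖b‖ ^ 2) + ENNReal.ofReal l * ENNReal.ofReal (‖b‖ ^ 2)) := by
        rw [ENNReal.ofReal_add (by positivity) (by positivity),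
          ENNReal.ofReal_add (by positivity) (by positivity),
          ENNReal.ofReal_mul (by positivity), ENNReal.ofReal_mul hl.le]

/-- For a finite `e` and `ε > 0` there is `λ > 0` with `λ e < ε`. [folklore] -/
theorem exists_pos_ofReal_mul_lt {e ε : ℝ≥0∞} (he : e ≠ ∞) (hε : 0 < ε) :
    ∃ l : ℝ, 0 < l ∧ ENNReal.ofReal l * e < ε := by
  have h1 : Tendsto (fun l : ℝ => ENNReal.ofReal l) (𝓝[>] (0 : ℝ)) (𝓝 0) := by
    have := ENNReal.tendsto_ofReal (tendsto_id (α := ℝ) (x := 𝓝 0))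
    rw [ENNReal.ofReal_zero] at this
    exact this.mono_left nhdsWithin_le_nhds
  have h2 : Tendsto (fun l : ℝ => ENNReal.ofReal l * e) (𝓝[>] (0 : ℝ)) (𝓝 0) := by
    have := ENNReal.Tendsto.mul_const h1 (Or.inr he)
    rwa [zero_mul] at this
  obtain ⟨l, hl, hl0⟩ := ((h2.eventually (gt_mem_nhds hε)).and self_mem_nhdsWithin).exists
  exact ⟨l, hl0, hl⟩

variable {α : Type*} [MeasurableSpace α] {μ : Measure α}

/-- A weighted lower integral with a weight `0 ≤ ψ ≤ Ψ` vanishing off a measurable `B` is at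
most `Ψ` times the integral over `B`. [folklore] -/
theorem lintegral_mul_ofReal_le_of_le {F : α → ℝ≥0∞} {ψ : α → ℝ} {Ψ : ℝ} (hψΨ : ∀ x, ψ x ≤ Ψ)
    {B : Set α} (hBm : MeasurableSet B) (hψB : ∀ x ∉ B, ψ x = 0) :
    ∫⁻ x, F x * ENNReal.ofReal (ψ x) ∂μ ≤ ENNReal.ofReal Ψ * ∫⁻ x in B, F x ∂μ := by
  calc ∫⁻ x, F x * ENNReal.ofReal (ψ x) ∂μ
      = ∫⁻ x, B.indicator (fun x => F x * ENNReal.ofReal (ψ x)) x ∂μ := by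
        refine lintegral_congr fun x => ?_
        by_cases hx : x ∈ B
        · rw [indicator_of_mem hx]
        · rw [indicator_of_notMem hx, hψB x hx, ENNReal.ofReal_zero, mul_zero]
    _ = ∫⁻ x in B, F x * ENNReal.ofReal (ψ x) ∂μ := lintegral_indicator hBm _
    _ ≤ ∫⁻ x in B, F x * ENNReal.ofReal Ψ ∂μ :=
        lintegral_mono fun x => mul_le_mul' le_rfl (ENNReal.ofReal_le_ofReal (hψΨ x))
    _ = ENNReal.ofReal Ψ * ∫⁻ x in B, F x ∂μ := by
        rw [lintegral_mul_const' _ _ ENNReal.ofReal_ne_top, mul_comm]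

/-- The weighted integral of the Peter–Paul bound: for `0 ≤ ψ ≤ Ψ` measurable vanishing off a
measurable `B` and `b` a.e.-measurable,
`∫ ‖a‖² ψ ≤ (1 + 1/λ) Ψ ∫_B ‖a − b‖² + (∫ ‖b‖² ψ + λ ∫ ‖b‖² ψ)`. [folklore] -/
theorem lintegral_sq_mul_le_peterPaul {a b : α → X} (hb : AEStronglyMeasurable b μ)
    {ψ : α → ℝ} {Ψ : ℝ} (hψm : Measurable ψ) (hψΨ : ∀ x, ψ x ≤ Ψ) {B : Set α}
    (hBm : MeasurableSet B) (hψB : ∀ x ∉ B, ψ x = 0) {l : ℝ} (hl : 0 < l) :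
    ∫⁻ x, ‖a x‖ₑ ^ 2 * ENNReal.ofReal (ψ x) ∂μ ≤
      ENNReal.ofReal (1 + 1 / l) * ENNReal.ofReal Ψ * ∫⁻ x in B, ‖a x - b x‖ₑ ^ 2 ∂μ +
        ((∫⁻ x, ‖b x‖ₑ ^ 2 * ENNReal.ofReal (ψ x) ∂μ) +
          ENNReal.ofReal l * ∫⁻ x, ‖b x‖ₑ ^ 2 * ENNReal.ofReal (ψ x) ∂μ) := by
  have hbm2 : AEMeasurable (fun x => ‖b x‖ₑ ^ 2 * ENNReal.ofReal (ψ x)) μ :=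
    (hb.enorm.pow_const 2).mul hψm.ennreal_ofReal.aemeasurable
  -- pointwise
  have hpt : ∀ x, ‖a x‖ₑ ^ 2 * ENNReal.ofReal (ψ x) ≤
      ENNReal.ofReal (1 + 1 / l) * (‖a x - b x‖ₑ ^ 2 * ENNReal.ofReal (ψ x)) +
        (‖b x‖ₑ ^ 2 * ENNReal.ofReal (ψ x) +
          ENNReal.ofReal l * (‖b x‖ₑ ^ 2 * ENNReal.ofReal (ψ x))) := fun x => by
    calc ‖a x‖ₑ ^ 2 * ENNReal.ofReal (ψ x)
        ≤ (ENNReal.ofReal (1 + 1 / l) * ‖a x - b x‖ₑ ^ 2 +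
            (‖b x‖ₑ ^ 2 + ENNReal.ofReal l * ‖b x‖ₑ ^ 2)) * ENNReal.ofReal (ψ x) := by
          gcongr
          exact enorm_sq_le_peterPaul _ _ hl
      _ = _ := by ring
  have hB' := lintegral_mul_ofReal_le_of_le (μ := μ) (F := fun x => ‖a x - b x‖ₑ ^ 2) hψΨ hBm hψB
  have hgm : AEMeasurable (fun x => ‖b x‖ₑ ^ 2 * ENNReal.ofReal (ψ x) +
      ENNReal.ofReal l * (‖b x‖ₑ ^ 2 * ENNReal.ofReal (ψ x))) μ := hbm2.add (hbm2.const_mul _)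
  calc ∫⁻ x, ‖a x‖ₑ ^ 2 * ENNReal.ofReal (ψ x) ∂μ
      ≤ ∫⁻ x, (ENNReal.ofReal (1 + 1 / l) * (‖a x - b x‖ₑ ^ 2 * ENNReal.ofReal (ψ x)) +
          (‖b x‖ₑ ^ 2 * ENNReal.ofReal (ψ x) +
            ENNReal.ofReal l * (‖b x‖ₑ ^ 2 * ENNReal.ofReal (ψ x)))) ∂μ := lintegral_mono hpt
    _ = ENNReal.ofReal (1 + 1 / l) * ∫⁻ x, ‖a x - b x‖ₑ ^ 2 * ENNReal.ofReal (ψ x) ∂μ +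
          ((∫⁻ x, ‖b x‖ₑ ^ 2 * ENNReal.ofReal (ψ x) ∂μ) +
            ENNReal.ofReal l * ∫⁻ x, ‖b x‖ₑ ^ 2 * ENNReal.ofReal (ψ x) ∂μ) := by
        rw [lintegral_add_right' _ hgm, lintegral_const_mul' _ _ ENNReal.ofReal_ne_top,
          lintegral_add_left' hbm2, lintegral_const_mul' _ _ ENNReal.ofReal_ne_top]
    _ ≤ _ := by
        rw [mul_assoc]
        gcongr

/-- **One-sided limit in weighted squares.** If `∫_B ‖f_j − g‖² → 0` and, frequently in `j`,
`∫ ‖f_j‖² ψ ≤ L` for a weight `0 ≤ ψ ≤ Ψ` vanishing off `B`, then `∫ ‖g‖² ψ ≤ L` (lower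
integrals; `‖g‖² ≤ (1 + 1/λ)‖g − f_j‖² + (1 + λ)‖f_j‖²`). [folklore] -/
theorem lintegral_sq_mul_le_of_tendsto {f : ℕ → α → X} {g : α → X}
    (hf : ∀ j, AEStronglyMeasurable (f j) μ) {ψ : α → ℝ} {Ψ : ℝ} (hψm : Measurable ψ)
    (hψΨ : ∀ x, ψ x ≤ Ψ) {B : Set α} (hBm : MeasurableSet B) (hψB : ∀ x ∉ B, ψ x = 0)
    (hd : Tendsto (fun j => ∫⁻ x in B, ‖f j x - g x‖ₑ ^ 2 ∂μ) atTop (𝓝 0)) {L : ℝ≥0∞}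
    (hL : ∃ᶠ j in atTop, ∫⁻ x, ‖f j x‖ₑ ^ 2 * ENNReal.ofReal (ψ x) ∂μ ≤ L) :
    ∫⁻ x, ‖g x‖ₑ ^ 2 * ENNReal.ofReal (ψ x) ∂μ ≤ L := by
  by_cases hLtop : L = ∞
  · rw [hLtop]; exact le_top
  refine ENNReal.le_of_forall_pos_le_add fun ε hε _ => ?_
  have hε2 : (0 : ℝ≥0∞) < ε / 2 := ENNReal.half_pos (ENNReal.coe_pos.2 hε).ne'
  obtain ⟨l, hl0, hl⟩ := exists_pos_ofReal_mul_lt hLtop hε2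
  set c : ℝ≥0∞ := ENNReal.ofReal (1 + 1 / l) * ENNReal.ofReal Ψ with hc
  have hctop : c ≠ ∞ := ENNReal.mul_ne_top ENNReal.ofReal_ne_top ENNReal.ofReal_ne_top
  have hsmall : ∀ᶠ j in atTop, c * ∫⁻ x in B, ‖f j x - g x‖ₑ ^ 2 ∂μ < ε / 2 := by
    have := ENNReal.Tendsto.const_mul hd (Or.inr hctop)
    rw [mul_zero] at this
    exact this.eventually (gt_mem_nhds hε2)
  obtain ⟨j, hj1, hj2⟩ := (hL.and_eventually hsmall).exists
  have hPP := lintegral_sq_mul_le_peterPaul (μ := μ) (a := g) (b := f j) (hf j) hψm hψΨ hBm hψB hl0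
  have hrev : ∫⁻ x in B, ‖g x - f j x‖ₑ ^ 2 ∂μ = ∫⁻ x in B, ‖f j x - g x‖ₑ ^ 2 ∂μ := by
    simp_rw [enorm_sub_rev (g _) (f j _)]
  rw [hrev] at hPP
  calc ∫⁻ x, ‖g x‖ₑ ^ 2 * ENNReal.ofReal (ψ x) ∂μ
      ≤ c * ∫⁻ x in B, ‖f j x - g x‖ₑ ^ 2 ∂μ +
          ((∫⁻ x, ‖f j x‖ₑ ^ 2 * ENNReal.ofReal (ψ x) ∂μ) +
            ENNReal.ofReal l * ∫⁻ x, ‖f j x‖ₑ ^ 2 * ENNReal.ofReal (ψ x) ∂μ) := hPP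
    _ ≤ ε / 2 + (L + ENNReal.ofReal l * L) := by
        gcongr
    _ ≤ ε / 2 + (L + ε / 2) := by gcongr
    _ = L + ε := by
        rw [show (ε : ℝ≥0∞) / 2 + (L + ε / 2) = L + (ε / 2 + ε / 2) by ring, ENNReal.add_halves]

/-- **Eventual one-sided bound in weighted squares.** If `∫_B ‖f_j − g‖² → 0` and
`∫ ‖g‖² ψ < ∞` then for every `ε > 0`, eventually `∫ ‖f_j‖² ψ ≤ ∫ ‖g‖² ψ + ε`. [folklore] -/
theorem eventually_lintegral_sq_mul_le_add {f : ℕ → α → X} {g : α → X}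
    (hg : AEStronglyMeasurable g μ) {ψ : α → ℝ} {Ψ : ℝ} (hψm : Measurable ψ)
    (hψΨ : ∀ x, ψ x ≤ Ψ) {B : Set α} (hBm : MeasurableSet B) (hψB : ∀ x ∉ B, ψ x = 0)
    (hd : Tendsto (fun j => ∫⁻ x in B, ‖f j x - g x‖ₑ ^ 2 ∂μ) atTop (𝓝 0))
    (hgfin : ∫⁻ x, ‖g x‖ₑ ^ 2 * ENNReal.ofReal (ψ x) ∂μ ≠ ∞) {ε : ℝ≥0∞} (hε : 0 < ε) :
    ∀ᶠ j in atTop, ∫⁻ x, ‖f j x‖ₑ ^ 2 * ENNReal.ofReal (ψ x) ∂μ ≤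
      (∫⁻ x, ‖g x‖ₑ ^ 2 * ENNReal.ofReal (ψ x) ∂μ) + ε := by
  have hε2 : (0 : ℝ≥0∞) < ε / 2 := ENNReal.half_pos hε.ne'
  obtain ⟨l, hl0, hl⟩ := exists_pos_ofReal_mul_lt hgfin hε2
  set c : ℝ≥0∞ := ENNReal.ofReal (1 + 1 / l) * ENNReal.ofReal Ψ with hc
  have hctop : c ≠ ∞ := ENNReal.mul_ne_top ENNReal.ofReal_ne_top ENNReal.ofReal_ne_top
  have hsmall : ∀ᶠ j in atTop, c * ∫⁻ x in B, ‖f j x - g x‖ₑ ^ 2 ∂μ < ε / 2 := by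
    have := ENNReal.Tendsto.const_mul hd (Or.inr hctop)
    rw [mul_zero] at this
    exact this.eventually (gt_mem_nhds hε2)
  filter_upwards [hsmall] with j hj
  have hPP := lintegral_sq_mul_le_peterPaul (μ := μ) (a := f j) (b := g) hg hψm hψΨ hBm hψB hl0
  calc ∫⁻ x, ‖f j x‖ₑ ^ 2 * ENNReal.ofReal (ψ x) ∂μ
      ≤ c * ∫⁻ x in B, ‖f j x - g x‖ₑ ^ 2 ∂μ +
          ((∫⁻ x, ‖g x‖ₑ ^ 2 * ENNReal.ofReal (ψ x) ∂μ) +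
            ENNReal.ofReal l * ∫⁻ x, ‖g x‖ₑ ^ 2 * ENNReal.ofReal (ψ x) ∂μ) := hPP
    _ ≤ ε / 2 + ((∫⁻ x, ‖g x‖ₑ ^ 2 * ENNReal.ofReal (ψ x) ∂μ) + ε / 2) := by
        gcongr
    _ = (∫⁻ x, ‖g x‖ₑ ^ 2 * ENNReal.ofReal (ψ x) ∂μ) + ε := by
        rw [show ε / 2 + ((∫⁻ x, ‖g x‖ₑ ^ 2 * ENNReal.ofReal (ψ x) ∂μ) + ε / 2) =
          (∫⁻ x, ‖g x‖ₑ ^ 2 * ENNReal.ofReal (ψ x) ∂μ) + (ε / 2 + ε / 2) by ring,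
          ENNReal.add_halves]

end Weighted

/-! ### Pairings against bounded fields under `L²` convergence on a set of finite measure -/

section Pairing

variable {α : Type*} [MeasurableSpace α] {μ : Measure α}
variable {V : Type*} [NormedAddCommGroup V]

/-- `‖f‖_{L²(μ|_B)} = (∫_B ‖f‖²)^{1/2}`. [folklore] -/
theorem eLpNorm_two_restrict_eq (f : α → V) (B : Set α) :
    eLpNorm f 2 (μ.restrict B) = (∫⁻ x in B, ‖f x‖ₑ ^ 2 ∂μ) ^ (1 / 2 : ℝ) := by
  rw [eLpNorm_eq_lintegral_rpow_enorm_toReal two_ne_zero ENNReal.ofNat_ne_top, ENNReal.toReal_ofNat]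
  congr 1
  refine lintegral_congr fun x => ?_
  rw [show (2 : ℝ) = ((2 : ℕ) : ℝ) by norm_num, ENNReal.rpow_natCast]

/-- A bounded a.e.-strongly measurable field is in `L²` of a set of finite measure. [folklore] -/
theorem eLpNorm_two_restrict_lt_top_of_bound {η : α → V} (hη : AEStronglyMeasurable η μ) {M : ℝ}
    (hηM : ∀ x, ‖η x‖ ≤ M) {B : Set α} (hμB : μ B < ∞) :
    eLpNorm η 2 (μ.restrict B) < ∞ := by
  haveI : IsFiniteMeasure (μ.restrict B) := ⟨by rwa [Measure.restrict_apply_univ]⟩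
  have htop : MemLp η ∞ (μ.restrict B) :=
    memLp_top_of_bound hη.restrict M (Eventually.of_forall hηM)
  exact (htop.mono_exponent le_top).2

variable [InnerProductSpace ℝ V]

/-- **Pairings converge under `L²` convergence on a set of finite measure.** If
`∫_B ‖f_j − g‖² → 0` with `f_j, g ∈ L²(B)` a.e.-strongly measurable, and `η` is a bounded
a.e.-strongly measurable field vanishing off a set `B` of finite measure, then
`∫ ⟪f_j, η⟫ → ∫ ⟪g, η⟫` (Cauchy–Schwarz). [folklore] -/
theorem tendsto_integral_inner_of_tendsto_lintegral {f : ℕ → α → V} {g η : α → V}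
    (hf : ∀ j, AEStronglyMeasurable (f j) μ) (hg : AEStronglyMeasurable g μ)
    (hη : AEStronglyMeasurable η μ) {M : ℝ} (hηM : ∀ x, ‖η x‖ ≤ M) {B : Set α}
    (hμB : μ B < ∞) (hηB : ∀ x ∉ B, η x = 0)
    (hf2 : ∀ j, ∫⁻ x in B, ‖f j x‖ₑ ^ 2 ∂μ < ∞) (hg2 : ∫⁻ x in B, ‖g x‖ₑ ^ 2 ∂μ < ∞)
    (hd : Tendsto (fun j => ∫⁻ x in B, ‖f j x - g x‖ₑ ^ 2 ∂μ) atTop (𝓝 0)) :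
    Tendsto (fun j => ∫ x, ⟪f j x, η x⟫ ∂μ) atTop (𝓝 (∫ x, ⟪g x, η x⟫ ∂μ)) := by
  set μB : Measure α := μ.restrict B with hμB_def
  -- everything happens on `B`
  have hred : ∀ h : α → V, ∫ x, ⟪h x, η x⟫ ∂μ = ∫ x, ⟪h x, η x⟫ ∂μB := fun h => by
    rw [hμB_def, setIntegral_eq_integral_of_forall_compl_eq_zero fun x hx => ?_]
    rw [hηB x hx, inner_zero_right]
  simp_rw [hred]
  -- `L²(B)` norms
  have hη2 : eLpNorm η 2 μB < ∞ := eLpNorm_two_restrict_lt_top_of_bound hη hηM hμB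
  have hf2' : ∀ j, eLpNorm (f j) 2 μB < ∞ := fun j => by
    rw [hμB_def, eLpNorm_two_restrict_eq]
    exact ENNReal.rpow_lt_top_of_nonneg (by norm_num) (hf2 j).ne
  have hg2' : eLpNorm g 2 μB < ∞ := by
    rw [hμB_def, eLpNorm_two_restrict_eq]
    exact ENNReal.rpow_lt_top_of_nonneg (by norm_num) hg2.ne
  have hif : ∀ j, Integrable (fun x => ⟪f j x, η x⟫) μB := fun j =>
    FunctionSpaces.integrable_inner_of_eLpNorm_two_lt_top (hf j).restrict hη.restrict (hf2' j) hη2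
  have hig : Integrable (fun x => ⟪g x, η x⟫) μB :=
    FunctionSpaces.integrable_inner_of_eLpNorm_two_lt_top hg.restrict hη.restrict hg2' hη2
  -- the difference is bounded by `‖f_j - g‖₂ ‖η‖₂`
  have hbound : ∀ j, ‖(∫ x, ⟪f j x, η x⟫ ∂μB) - ∫ x, ⟪g x, η x⟫ ∂μB‖ₑ ≤
      (∫⁻ x in B, ‖f j x - g x‖ₑ ^ 2 ∂μ) ^ (1 / 2 : ℝ) * eLpNorm η 2 μB := by
    intro j
    rw [← integral_sub (hif j) hig]
    have e : (fun x => ⟪f j x, η x⟫ - ⟪g x, η x⟫) = fun x => ⟪f j x - g x, η x⟫ := by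
      funext x; rw [inner_sub_left]
    rw [e, ← eLpNorm_two_restrict_eq]
    exact FunctionSpaces.enorm_integral_inner_le_eLpNorm_mul ((hf j).sub hg).restrict hη.restrict
  -- the right-hand side tends to `0`
  have hrt : Tendsto (fun j => (∫⁻ x in B, ‖f j x - g x‖ₑ ^ 2 ∂μ) ^ (1 / 2 : ℝ) * eLpNorm η 2 μB)
      atTop (𝓝 0) := by
    have h1 : Tendsto (fun j => (∫⁻ x in B, ‖f j x - g x‖ₑ ^ 2 ∂μ) ^ (1 / 2 : ℝ)) atTop (𝓝 0) := by
      have := ((ENNReal.continuous_rpow_const (y := (1 / 2 : ℝ))).tendsto (0 : ℝ≥0∞)).comp hd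
      rwa [ENNReal.zero_rpow_of_pos (by norm_num : (0 : ℝ) < 1 / 2)] at this
    have := ENNReal.Tendsto.mul_const h1 (Or.inr hη2.ne)
    rwa [zero_mul] at this
  rw [tendsto_iff_edist_tendsto_0]
  refine tendsto_of_tendsto_of_tendsto_of_le_of_le tendsto_const_nhds hrt (fun j => bot_le)
    fun j => ?_
  rw [edist_eq_enorm_sub]
  exact hbound j

end Pairing

end Literature.Analysis.FluidPDE
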